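import Summits.BirchSwinnertonDyer.Rank1Residual.X2.IsogenyClassStability
import Literature.NumberTheory.EllipticCurves.KummerSelmerStructure
import HarnessLib

/-!
# Surjectivity of `ρ̄_{E,p^n}` is constant on `ℚ`-isogeny classes with `E[p]` irreducible
# (cell `b2b-bsdres`, seat additive-p4, GEN 18, line V33 part A)

HONEST FRAMING (cell `b2b-bsdres`, run/shared/lean/b2b/bsd-rank1-residual/, verbatim in every
file): the goal of the cell is to DELETE the COMBINATION-SHAPED residual classes of the
Birch–Swinnerton-Dyer formula for ALL analytic-rank `≤ 1` elliptic curves over `ℚ` — "full BSD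
formula for every rank `≤ 1` curve in class `C`" assembled STRICTLY from published theorems — so
that the rank-`≤ 1` remainder becomes exactly the CONSTRUCTION-SHAPED classes, which are TYPED
(missing-input `Prop`s), NOT attempted. This is not "finishing BSD". Seat `additive-p4`
(CLASS-OWNERS row "X3♯/X4♯ direct"): research route on the CONSTRUCTION-SHAPED class X4; theorems
only (no definition, no named fact); labels UNCHANGED; nothing booked.

## What this file proves

The tree transports along `ℚ`-isogenies: reducibility / irreducibility of `E[p]`
(`not_hasIrreducibleModPGaloisRep_of_isIsogenous`, `X12.irr_iff_of_isIsogenous`,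
`X2.red_iff_of_isIsogenous`), the reduction type (`addv_iff_of_isIsogenous`,
`mult_iff_of_isIsogenous`), the classes `ClassX2/X3/X4` (`X2.classX{2,3,4}_iff_of_isIsogenous`), the
(G)-shapes, the GV parity type, CM. It does NOT transport the IMAGE binder `Surj W p`
(`ρ̄_{E,p}` onto) or the `p`-adic TOWER `∀ n, ρ̄_{E,p^n}` onto — the binders of every Kato / Kim
consumer of class X4 — except along a BIJECTIVE isogeny
(`hasSurjectiveModNGaloisRep_of_isogeny_bijective`, i.e. a change of model). In general surjectivity
is NOT a class invariant (a `p`-isogenous curve has reducible `E[p]`); on an IRREDUCIBLE class it is: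

* §1 `Isogeny.eq_zero_of_mem_geomTorsion_of_irr`: an isogeny `f : E → E'` over `ℚ` not killing
  `E[p]`, with `E[p]` irreducible, kills NO non-zero point of `E[p]` (`ker f ∩ E[p]` is a
  `Γ_ℚ`-stable proper subgroup); `Isogeny.eq_zero_of_mem_geomTorsion_pow_of_irr`: hence no non-zero
  point of `E[p^n]` (a kernel element of order `p^{k+1}` has a multiple of order `p` in the kernel).
* §2 `exists_geomTorsion_pow_addEquiv_of_isogeny_of_irr`: so `f` restricts to a `Γ_ℚ`-equivariant
  isomorphism `E[p^n] ≃+ E'[p^n]` (injective between groups of the same order `p^{2n}`);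
  `hasSurjectiveModNGaloisRep_of_geomTorsion_addEquiv`: surjectivity of `ρ̄` passes along any
  equivariant isomorphism of torsion groups (conjugation).
* §3 **`surj_pow_iff_of_isIsogenous_of_irr`**: `W ∼ W'` over `ℚ`, `E[p]` irreducible ⟹
  (`ρ̄_{W,p^n}` onto ⟺ `ρ̄_{W',p^n}` onto) for every `n`; **`surj_iff_of_isIsogenous_of_irr`**
  (`n = 1`), **`towerSurj_iff_of_isIsogenous_of_irr`** (all `n` at once),
  **`surj_iff_of_isIsogenous_of_classX4`**, **`classX4_and_surj_iff_of_isIsogenous`** — on class X4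
  (`E[p]` irreducible by definition) the image binder and the `3`-adic tower certificate of the
  cell's chain of record are properties of the Cremona class, so every "isogenous curve with …"
  clause of the END-STATE theorems (`X4/KimConjectureIsogenyOptimal.lean` §3 clause (ii)) may drop
  its `ClassX4 W₀ p ∧ Surj W₀ p` conjuncts (sequel file, part B).

Inputs: the tree's `exists_isogeny_apply_ne_zero` (every isogenous pair is joined by an isogeny not
killing `E[p]`: peel off factors `[p]`, Silverman *AEC* III.4.11), `natCard_geomTorsion`
(`#E[m] = m²`, *AEC* III.6.4 (b)), the equivariance field of `Isogeny`. No reduction hypothesis, no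
hypothesis on `p` (any prime, `p = 2` included).

References: J. H. Silverman, *AEC* 2nd ed., III.4.11, III.6.4 (b), III.7 [SilvermanAEC2009];
J.-P. Serre, Invent. Math. 15 (1972) §4 [Serre1972].
-/

noncomputable section

open scoped Classical

open WeierstrassCurve Literature.NumberTheory.EllipticCurves
  Literature.NumberTheory.EllipticCurves.Rank1Residual

namespace Summit.BirchSwinnertonDyer.Rank1Residual.GaloisImage

variable {W W' : WeierstrassCurve ℚ} [W.IsElliptic] [W'.IsElliptic] {p : ℕ} [hp : Fact p.Prime]

/-! ### §1 An isogeny not killing `E[p]` is injective on `E[p^n]` when `E[p]` is irreducible -/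

omit [W.IsElliptic] [W'.IsElliptic] in
/-- **`ker f ∩ E[p] = 0`**: for an isogeny `f : E → E'` over `ℚ` with `f(E[p]) ≠ 0` and `E[p]`
irreducible, every `P ∈ E[p]` with `f P = 0` is `0` — `ker f ∩ E[p]` is a `Γ_ℚ`-stable subgroup of
`E[p]` (equivariance of `f`), not all of `E[p]`, hence trivial. [folklore] -/
theorem Isogeny.eq_zero_of_mem_geomTorsion_of_irr (f : Isogeny W W')
    (hf : ∃ P : geomPoints W, P ∈ geomTorsion W (p : ℤ) ∧ f P ≠ 0) (hirr : Irr W p)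
    {P : geomPoints W} (hP : P ∈ geomTorsion W (p : ℤ)) (h0 : f P = 0) : P = 0 := by
  let K : AddSubgroup (geomTorsion W (p : ℤ)) :=
    f.toAddMonoidHom.ker.comap (geomTorsion W (p : ℤ)).subtype
  have hmemK : ∀ Q : geomTorsion W (p : ℤ), Q ∈ K ↔ f (Q : geomPoints W) = 0 := fun Q ↦ by
    simp only [K, AddSubgroup.mem_comap, AddMonoidHom.mem_ker, AddSubgroup.coe_subtype,
      Isogeny.coe_toAddMonoidHom]
  have hK : ∀ σ : Field.absoluteGaloisGroup ℚ, ∀ Q ∈ K, σ • Q ∈ K := by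
    intro σ Q hQ
    rw [hmemK] at hQ ⊢
    rw [AddSubgroup.torsionBy.coe_smul, f.map_smul, hQ, smul_zero]
  rcases hirr K hK with hbot | htop
  · have hPK : (⟨P, hP⟩ : geomTorsion W (p : ℤ)) ∈ K := (hmemK _).mpr h0
    rw [hbot, AddSubgroup.mem_bot] at hPK
    exact congrArg Subtype.val hPK
  · exfalso
    obtain ⟨Q, hQ, hfQ⟩ := hf
    have hQK : (⟨Q, hQ⟩ : geomTorsion W (p : ℤ)) ∈ K := htop ▸ AddSubgroup.mem_top _
    exact hfQ ((hmemK _).mp hQK)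

omit [W.IsElliptic] [W'.IsElliptic] in
/-- **`ker f ∩ E[p^n] = 0`** under the same hypotheses, for every `n`: if `P ∈ E[p^{n+1}]` and
`f P = 0` then `p^n P ∈ ker f ∩ E[p] = 0`, so `P ∈ E[p^n]`; induct. [folklore] -/
theorem Isogeny.eq_zero_of_mem_geomTorsion_pow_of_irr (f : Isogeny W W')
    (hf : ∃ P : geomPoints W, P ∈ geomTorsion W (p : ℤ) ∧ f P ≠ 0) (hirr : Irr W p) (n : ℕ)
    {P : geomPoints W} (hP : P ∈ geomTorsion W ((p ^ n : ℕ) : ℤ)) (h0 : f P = 0) : P = 0 := by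
  induction n generalizing P with
  | zero =>
    have h1 : (p ^ 0 : ℕ) • P = 0 := AddSubgroup.torsionBy.nsmul_iff.mp hP
    simpa using h1
  | succ n ih =>
    have hPn1 : (p ^ (n + 1) : ℕ) • P = 0 := AddSubgroup.torsionBy.nsmul_iff.mp hP
    -- `Q = p^n • P ∈ E[p]`, `f Q = 0`
    have hQ : (p ^ n : ℕ) • P ∈ geomTorsion W (p : ℤ) := by
      refine AddSubgroup.torsionBy.nsmul_iff.mpr ?_
      rw [smul_smul, ← pow_succ', hPn1]
    have hfQ : f ((p ^ n : ℕ) • P) = 0 := by rw [map_nsmul, h0, smul_zero]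
    have hQ0 : (p ^ n : ℕ) • P = 0 := Isogeny.eq_zero_of_mem_geomTorsion_of_irr f hf hirr hQ hfQ
    exact ih (AddSubgroup.torsionBy.nsmul_iff.mpr hQ0) h0

/-! ### §2 The equivariant isomorphism `E[p^n] ≃ E'[p^n]` and transport of surjectivity -/

/-- **An isogeny not killing `E[p]`, `E[p]` irreducible, restricts to a `Γ_ℚ`-equivariant
isomorphism `E[p^n] ≃+ E'[p^n]`** (injective by §1 between finite groups of the same order
`p^{2n}`, `natCard_geomTorsion`). [cite: SilvermanAEC2009, Cor. III.6.4(b)] -/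
theorem exists_geomTorsion_pow_addEquiv_of_isogeny_of_irr (f : Isogeny W W')
    (hf : ∃ P : geomPoints W, P ∈ geomTorsion W (p : ℤ) ∧ f P ≠ 0) (hirr : Irr W p) (n : ℕ) :
    ∃ e : geomTorsion W ((p ^ n : ℕ) : ℤ) ≃+ geomTorsion W' ((p ^ n : ℕ) : ℤ),
      (∀ P, ((e P : geomTorsion W' ((p ^ n : ℕ) : ℤ)) : geomPoints W') = f (P : geomPoints W)) ∧
      ∀ (σ : Field.absoluteGaloisGroup ℚ) (P : geomTorsion W ((p ^ n : ℕ) : ℤ)),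
        e (σ • P) = σ • e P := by
  set m : ℕ := p ^ n with hm
  have hm0 : (m : ℤ) ≠ 0 := by exact_mod_cast (pow_ne_zero n hp.out.ne_zero : p ^ n ≠ 0)
  have hmem : ∀ P : geomTorsion W (m : ℤ), f (P : geomPoints W) ∈ geomTorsion W' (m : ℤ) := by
    intro P
    have hPm : m • (P : geomPoints W) = 0 := AddSubgroup.torsionBy.nsmul_iff.mp P.2
    exact AddSubgroup.torsionBy.nsmul_iff.mpr (by rw [← map_nsmul, hPm, map_zero])
  let g : geomTorsion W (m : ℤ) →+ geomTorsion W' (m : ℤ) :=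
    { toFun := fun P ↦ ⟨f (P : geomPoints W), hmem P⟩
      map_zero' := Subtype.ext (map_zero f)
      map_add' := fun P Q ↦ Subtype.ext (map_add f (P : geomPoints W) (Q : geomPoints W)) }
  have hgval : ∀ P : geomTorsion W (m : ℤ), ((g P : geomTorsion W' (m : ℤ)) : geomPoints W') =
      f (P : geomPoints W) := fun _ ↦ rfl
  -- injective (§1)
  have hinj : Function.Injective g := by
    intro P Q hPQ
    have h0 : f ((P : geomPoints W) - (Q : geomPoints W)) = 0 := by
      rw [map_sub, sub_eq_zero]
      exact congrArg Subtype.val hPQ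
    have hPQm : (P : geomPoints W) - (Q : geomPoints W) ∈ geomTorsion W (m : ℤ) :=
      (geomTorsion W (m : ℤ)).sub_mem P.2 Q.2
    exact Subtype.ext (sub_eq_zero.mp
      (Isogeny.eq_zero_of_mem_geomTorsion_pow_of_irr f hf hirr n hPQm h0))
  -- same finite cardinality `m²`
  have hcW : Nat.card (geomTorsion W (m : ℤ)) = m ^ 2 := by
    rw [WeierstrassCurve.natCard_geomTorsion W (m : ℤ) hm0, Int.natAbs_natCast]
  have hcW' : Nat.card (geomTorsion W' (m : ℤ)) = m ^ 2 := by
    rw [WeierstrassCurve.natCard_geomTorsion W' (m : ℤ) hm0, Int.natAbs_natCast]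
  have hmpos : m ^ 2 ≠ 0 := pow_ne_zero 2 (pow_ne_zero n hp.out.ne_zero)
  haveI : Finite (geomTorsion W (m : ℤ)) := Nat.finite_of_card_ne_zero (by rw [hcW]; exact hmpos)
  haveI : Finite (geomTorsion W' (m : ℤ)) := Nat.finite_of_card_ne_zero (by rw [hcW']; exact hmpos)
  have hbij : Function.Bijective g :=
    (Nat.bijective_iff_injective_and_card g).mpr ⟨hinj, by rw [hcW, hcW']⟩
  refine ⟨AddEquiv.ofBijective g hbij, fun P ↦ rfl, fun σ P ↦ ?_⟩
  apply Subtype.ext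
  change ((g (σ • P) : geomTorsion W' (m : ℤ)) : geomPoints W') = _
  rw [hgval, AddSubgroup.torsionBy.coe_smul, f.map_smul, AddSubgroup.torsionBy.coe_smul, ← hgval]
  rfl

omit [W.IsElliptic] [W'.IsElliptic] in
/-- **Surjectivity of `ρ̄` passes along a `Γ_ℚ`-equivariant isomorphism of torsion groups**:
if `e : E[m] ≃+ E'[m]` commutes with `Γ_ℚ` and `ρ̄_{E,m}` is onto `Aut(E[m])`, then `ρ̄_{E',m}`
is onto `Aut(E'[m])` (conjugate a given automorphism of `E'[m]` back to `E[m]`, realise it by some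
`σ`, push forward). [cite: Serre1972, §4] -/
theorem hasSurjectiveModNGaloisRep_of_geomTorsion_addEquiv {m : ℤ}
    (e : geomTorsion W m ≃+ geomTorsion W' m)
    (he : ∀ (σ : Field.absoluteGaloisGroup ℚ) (P : geomTorsion W m), e (σ • P) = σ • e P)
    (h : W.HasSurjectiveModNGaloisRep m) : W'.HasSurjectiveModNGaloisRep m := by
  intro g
  set g' : AddAut (geomTorsion W m) := e.trans ((Multiplicative.toAdd g).trans e.symm) with hg'
  obtain ⟨σ, hσ⟩ := h (Multiplicative.ofAdd g')
  refine ⟨σ, ?_⟩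
  apply Multiplicative.toAdd.injective
  refine AddEquiv.ext fun Q ↦ ?_
  obtain ⟨P, rfl⟩ := e.surjective Q
  have h1 : Multiplicative.toAdd (galoisRepTorsion W' m σ) (e P) = σ • e P := rfl
  have h2 : Multiplicative.toAdd (galoisRepTorsion W m σ) P = σ • P := rfl
  rw [h1, ← he, ← h2, hσ, toAdd_ofAdd, hg', AddEquiv.trans_apply, AddEquiv.trans_apply,
    AddEquiv.apply_symm_apply]

/-! ### §3 `Surj` and the `p`-adic tower are class invariants on irreducible classes -/

/-- One direction along a given isogenous pair: `W ∼ W'`, `E[p]` irreducible, `ρ̄_{W,p^n}` onto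
⟹ `ρ̄_{W',p^n}` onto. [folklore] -/
theorem surj_pow_of_isIsogenous_of_irr (h : IsIsogenous W W') (hirr : Irr W p) (n : ℕ)
    (hs : W.HasSurjectiveModNGaloisRep ((p ^ n : ℕ) : ℤ)) :
    W'.HasSurjectiveModNGaloisRep ((p ^ n : ℕ) : ℤ) := by
  obtain ⟨f, P, hP, hfP⟩ := exists_isogeny_apply_ne_zero (p := p) h
  obtain ⟨e, -, he⟩ := exists_geomTorsion_pow_addEquiv_of_isogeny_of_irr f ⟨P, hP, hfP⟩ hirr n
  exact hasSurjectiveModNGaloisRep_of_geomTorsion_addEquiv e he hs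

/-- **`ρ̄_{E,p^n}` onto is a property of the `ℚ`-isogeny class when `E[p]` is irreducible**:
`W ∼ W'`, `Irr W p` ⟹ (`ρ̄_{W,p^n}` onto ⟺ `ρ̄_{W',p^n}` onto), every `n` (irreducibility
passes to `W'` by `not_hasIrreducibleModPGaloisRep_of_isIsogenous`; the reverse isogeny is the dual). [folklore] -/
theorem surj_pow_iff_of_isIsogenous_of_irr (h : IsIsogenous W W') (hirr : Irr W p) (n : ℕ) :
    W.HasSurjectiveModNGaloisRep ((p ^ n : ℕ) : ℤ) ↔ W'.HasSurjectiveModNGaloisRep ((p ^ n : ℕ) : ℤ) :=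
  ⟨surj_pow_of_isIsogenous_of_irr h hirr n,
    surj_pow_of_isIsogenous_of_irr h.symm_of_charZero
      (by_contra fun hirr' ↦ not_hasIrreducibleModPGaloisRep_of_isIsogenous h.symm_of_charZero hirr' hirr) n⟩

/-- **`Surj W p ⟺ Surj W' p` on an irreducible isogeny class** (`n = 1`). [folklore] -/
theorem surj_iff_of_isIsogenous_of_irr (h : IsIsogenous W W') (hirr : Irr W p) :
    Surj W p ↔ Surj W' p := by
  simpa [Surj, pow_one] using surj_pow_iff_of_isIsogenous_of_irr h hirr 1

/-- **The `p`-adic tower `∀ n, ρ̄_{E,p^n}` onto is a property of an irreducible isogeny class**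
(the cell's `towerSurj` certificate — Kato's (12.5.2) binder at `p = 3` — transports along
Cremona classes). [folklore] -/
theorem towerSurj_iff_of_isIsogenous_of_irr (h : IsIsogenous W W') (hirr : Irr W p) :
    (∀ n : ℕ, W.HasSurjectiveModNGaloisRep ((p ^ n : ℕ) : ℤ)) ↔
      ∀ n : ℕ, W'.HasSurjectiveModNGaloisRep ((p ^ n : ℕ) : ℤ) :=
  forall_congr' fun n ↦ surj_pow_iff_of_isIsogenous_of_irr h hirr n

/-- **On class X4 (`E[p]` irreducible by definition) the image binder is a class property**:
`W ∼ W'`, `ClassX4 W p` ⟹ (`Surj W p ⟺ Surj W' p`). [folklore] -/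
theorem surj_iff_of_isIsogenous_of_classX4 (h : IsIsogenous W W') (hX : ClassX4 W p) :
    Surj W p ↔ Surj W' p :=
  surj_iff_of_isIsogenous_of_irr h hX.2.2

/-- **`ClassX4 W p ∧ Surj W p` is a property of the `ℚ`-isogeny class** (X2's
`classX4_iff_of_isIsogenous` + §3). [folklore] -/
theorem classX4_and_surj_iff_of_isIsogenous (h : IsIsogenous W W') :
    (ClassX4 W p ∧ Surj W p) ↔ (ClassX4 W' p ∧ Surj W' p) := by
  constructor
  · rintro ⟨hX, hs⟩
    exact ⟨(X2.classX4_iff_of_isIsogenous h).mp hX, (surj_iff_of_isIsogenous_of_classX4 h hX).mp hs⟩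
  · rintro ⟨hX', hs'⟩
    have hX : ClassX4 W p := (X2.classX4_iff_of_isIsogenous h).mpr hX'
    exact ⟨hX, (surj_iff_of_isIsogenous_of_classX4 h hX).mpr hs'⟩

/-- **The tower certificate on class X4 is a class property**: `W ∼ W'`, `ClassX4 W p` ⟹
(`∀ n, ρ̄_{W,p^n}` onto ⟺ `∀ n, ρ̄_{W',p^n}` onto). [folklore] -/
theorem towerSurj_iff_of_isIsogenous_of_classX4 (h : IsIsogenous W W') (hX : ClassX4 W p) :
    (∀ n : ℕ, W.HasSurjectiveModNGaloisRep ((p ^ n : ℕ) : ℤ)) ↔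
      ∀ n : ℕ, W'.HasSurjectiveModNGaloisRep ((p ^ n : ℕ) : ℤ) :=
  towerSurj_iff_of_isIsogenous_of_irr h hX.2.2

end Summit.BirchSwinnertonDyer.Rank1Residual.GaloisImage

end
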